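import Summits.QuantumFields.BalabanUV.T4Continuum.Support.NE7K1LinSchurHarmonicExt

/-!
# NE7K1LinSchurBilinError — row NE7 (node U5), candidate route HOM, path H1L, cell K1-lin(s): (π6)(ii) for the SCHUR member, abstract —
# the bilinear conjugation error of `S(H) = A − BD⁻¹C` is bounded FORM-RELATIVELY by that of `H`, given a FLUCTUATION FLOOR
# `⟨(0,ψ),H(0,ψ)⟩ ≥ d₀‖ψ‖²` and a COARSE CEILING `⟨(z,0),H(z,0)⟩ ≤ a₀‖z‖²` (only `a₀∕d₀` and `1∕√d₀` enter)

Lineage `b2b-balaban-t4-ne7-p2` (CRUX PROVER NE7 #2), generation 64; with `NE7K1LinSchurHarmonicExt` (`err_S(z,u) = err_H(Ez, E_ρu)`),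
`NE7K1LinBilinConjError` ∕ `NE7K1LinFineOpBilinWeight` (the finite-range member) and `NE7K1LinSchurLineDerivRelWX` (the weighted letter
with the four-term hypothesis) this is the last ABSTRACT piece of (π6): at U = 1, `a₀ ≍ 4(d+1)n²L² + a` and `d₀ = 2n²L^{−(d+1)}`
(block Poincaré on fluctuations) are both of order `n²`, so `a₀∕d₀` and `1∕d₀ ≤ L^{d+1}∕2` are mesh-free.  [folklore]:
* `form_inr` ∕ `dot_inr_hext`: bookkeeping on coarse ⊕ fine; `isUnit_D` ∕ `isUnit_Dρ` (the fine blocks of `H` and of `conjW ρ H` are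
  invertible under coercivity + the quadratic conjugation-error bound);
* `fluct_energy_le` : `⟨ψ_z, Dψ_z⟩ ≤ ⟨(z,0),H(z,0)⟩` for `ψ_z = D⁻¹Cz` (polarised AM–GM at `λ = 1`); `norm_hext_sq_le`:
  `‖Ez‖² ≤ (1 + a₀∕d₀)‖z‖²`;
* `corr_energy_le` : with `χ = ψ^ρ_u − ψ_u` and `X² = ⟨χ,Dχ⟩`: `X ≤ 2κ((1 + 1∕√d₀)‖Eu‖ + √E_S(u)∕√d₀)` (energy form of Combes–Thomas
  on `D` + `⟨χ,D_ρχ⟩ = err_H((0,χ), Eu)`);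
* **`bilin_conjError_schur_le`**: `|⟨z,(conjW ρ_c S)u⟩ − ⟨z,Su⟩| ≤ κ·(√E_S(z)·(e‖u‖ + X∕√d₀) + e‖z‖·(√E_S(u) + X) + e‖z‖·(e‖u‖ + X∕√d₀))`
  with `e = √(1 + a₀∕d₀)`, `E_S(v) = ⟨v,Sv⟩`, `X` as above — every factor of the allowed four shapes
  (`√E_S(z)‖u‖`, `‖z‖√E_S(u)`, `‖z‖‖u‖`, `√E_S(z)√E_S(u)`).

HONEST FRAMING: [folklore] finite real matrices; the U = 1 instantiation (a₀, d₀, the H-error via congruence from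
`NE7K1LinFineOpBilinWeight`) is NOT here; nothing printed asserted; no `sorry`.  FIXED FINITE T⁴, rung (B)+1; NE7 NOT PRINTED ∕ NOT
PROVED; spine 0∕9; NOT infinite volume, NOT mass gap, NOT Clay.  HONEST DEPENDENCY: continuum YM on T⁴ ⇐ BetaPertH ∧ nine spine
estimates (0/9 proved); BetaPertH ⇐ (D1) ∧ (D4) ∧ CAP+tail; G-an2-4 gates asym, D1 and NE2/3/4.
-/

noncomputable section

open Finset Matrix

namespace Summit.QuantumFields.BalabanUV.T4Continuum.NE7K1LinSchurBilinError

open NE7K1LinSchurLineForm NE7K1LinConjW NE7K1LinSchurLineDerivRel NE7K1LinSchurHarmonicExt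

variable {ιc ιf : Type*} [Fintype ιc] [Fintype ιf] [DecidableEq ιc] [DecidableEq ιf]

omit [DecidableEq ιc] [DecidableEq ιf] in
/-- `⟨(0,ψ), M(0,ψ)⟩ = ⟨ψ, M₂₂ψ⟩`. [folklore] -/
theorem form_inr (M : Matrix (ιc ⊕ ιf) (ιc ⊕ ιf) ℝ) (ψ : ιf → ℝ) :
    Sum.elim 0 ψ ⬝ᵥ M.mulVec (Sum.elim 0 ψ) = ψ ⬝ᵥ (M.toBlocks₂₂).mulVec ψ := by
  conv_lhs => rw [← fromBlocks_toBlocks M]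
  rw [fromBlocks_mulVec, Sum.elim_comp_inl, Sum.elim_comp_inr, sumElim_dotProduct_sumElim, zero_dotProduct, zero_add,
    mulVec_zero, zero_add]

omit [DecidableEq ιc] [DecidableEq ιf] in
/-- `⟨(0,ψ), M(u, φ)⟩ = ⟨ψ, M₂₁u + M₂₂φ⟩`. [folklore] -/
theorem dot_inr_mulVec (M : Matrix (ιc ⊕ ιf) (ιc ⊕ ιf) ℝ) (ψ : ιf → ℝ) (u : ιc → ℝ) (φ : ιf → ℝ) :
    Sum.elim 0 ψ ⬝ᵥ M.mulVec (Sum.elim u φ) = ψ ⬝ᵥ ((M.toBlocks₂₁).mulVec u + (M.toBlocks₂₂).mulVec φ) := by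
  conv_lhs => rw [← fromBlocks_toBlocks M]
  rw [fromBlocks_mulVec, Sum.elim_comp_inl, Sum.elim_comp_inr, sumElim_dotProduct_sumElim, zero_dotProduct, zero_add]

omit [DecidableEq ιc] [DecidableEq ιf] in
/-- `‖(z,φ)‖² = ‖z‖² + ‖φ‖²`. [folklore] -/
theorem dot_sumElim_self (z : ιc → ℝ) (φ : ιf → ℝ) : Sum.elim z φ ⬝ᵥ Sum.elim z φ = z ⬝ᵥ z + φ ⬝ᵥ φ :=
  sumElim_dotProduct_sumElim z z φ φ

omit [DecidableEq ιc] in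
/-- the fine block of a coercive `H` is invertible. [folklore] -/
theorem isUnit_D (H : Matrix (ιc ⊕ ιf) (ιc ⊕ ιf) ℝ) {σ : ℝ} (hσ : 0 < σ) (hH : ∀ v, σ * (v ⬝ᵥ v) ≤ v ⬝ᵥ H.mulVec v) :
    IsUnit (H.toBlocks₂₂).det := by
  refine isUnit_det_of_coercive _ hσ fun ψ => ?_
  have h := hH (Sum.elim 0 ψ)
  rwa [form_inr, dot_sumElim_self, zero_dotProduct, zero_add] at h

omit [DecidableEq ιc] in
/-- the fine block of the CONJUGATED `H` is invertible (energy form of Combes–Thomas on `D`). [folklore] -/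
theorem isUnit_Dρ (H : Matrix (ιc ⊕ ιf) (ιc ⊕ ιf) ℝ) (ρ : ιc ⊕ ιf → ℝ) {σ : ℝ} (hσ : 0 < σ)
    (hH : ∀ v, σ * (v ⬝ᵥ v) ≤ v ⬝ᵥ H.mulVec v)
    (herr : ∀ v, -(σ / 2) * (v ⬝ᵥ v) ≤ v ⬝ᵥ (conjW ρ H).mulVec v - v ⬝ᵥ H.mulVec v) :
    IsUnit ((conjW ρ H).toBlocks₂₂).det ∧
      ∀ χ : ιf → ℝ, (χ ⬝ᵥ (H.toBlocks₂₂).mulVec χ) / 2 ≤ χ ⬝ᵥ ((conjW ρ H).toBlocks₂₂).mulVec χ := by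
  have hD : ∀ ψ : ιf → ℝ, σ * (ψ ⬝ᵥ ψ) ≤ ψ ⬝ᵥ (H.toBlocks₂₂).mulVec ψ := fun ψ => by
    have h := hH (Sum.elim 0 ψ); rwa [form_inr, dot_sumElim_self, zero_dotProduct, zero_add] at h
  have hDerr : ∀ ψ : ιf → ℝ, -(σ / 2) * (ψ ⬝ᵥ ψ) ≤
      ψ ⬝ᵥ (conjW (ρ ∘ Sum.inr) H.toBlocks₂₂).mulVec ψ - ψ ⬝ᵥ (H.toBlocks₂₂).mulVec ψ := fun ψ => by
    have h := herr (Sum.elim 0 ψ)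
    rwa [form_inr, form_inr, dot_sumElim_self, zero_dotProduct, zero_add, (toBlocks_conjW ρ H).2.1] at h
  rw [(toBlocks_conjW ρ H).2.1]
  refine ⟨(energy_of_conj_inv (ρ ∘ Sum.inr) H.toBlocks₂₂ hσ hD hDerr 0).1, fun χ => (coercive_conjW _ _ hD hDerr χ).2⟩

/-! ### the two harmonic extensions and their sizes -/

omit [DecidableEq ιc] in
/-- **FLUCTUATION ENERGY OF THE HARMONIC EXTENSION**: `⟨ψ_z, Dψ_z⟩ ≤ ⟨(z,0), H(z,0)⟩`, `ψ_z = D⁻¹Cz` (`H` symmetric PSD).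
[folklore] -/
theorem fluct_energy_le (H : Matrix (ιc ⊕ ιf) (ιc ⊕ ιf) ℝ) (hHs : H.IsSymm) (hpsd : ∀ v, 0 ≤ v ⬝ᵥ H.mulVec v)
    (hD : IsUnit (H.toBlocks₂₂).det) (z : ιc → ℝ) :
    (H.toBlocks₂₂)⁻¹.mulVec (H.toBlocks₂₁.mulVec z) ⬝ᵥ (H.toBlocks₂₂).mulVec ((H.toBlocks₂₂)⁻¹.mulVec (H.toBlocks₂₁.mulVec z))
      ≤ Sum.elim z 0 ⬝ᵥ H.mulVec (Sum.elim z 0) := by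
  set ψ := (H.toBlocks₂₂)⁻¹.mulVec (H.toBlocks₂₁.mulVec z) with hψ
  have hDψ : (H.toBlocks₂₂).mulVec ψ = H.toBlocks₂₁.mulVec z := by
    rw [hψ, mulVec_mulVec, mul_nonsing_inv _ hD, one_mulVec]
  -- `⟨ψ,Dψ⟩ = ⟨(0,ψ),H(0,ψ)⟩` and `⟨(0,ψ),H(z,0)⟩ = ⟨ψ, Cz⟩ = ⟨ψ, Dψ⟩`
  have h1 : ψ ⬝ᵥ (H.toBlocks₂₂).mulVec ψ = Sum.elim 0 ψ ⬝ᵥ H.mulVec (Sum.elim 0 ψ) := (form_inr H ψ).symm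
  have h2 : Sum.elim 0 ψ ⬝ᵥ H.mulVec (Sum.elim z 0) = ψ ⬝ᵥ (H.toBlocks₂₂).mulVec ψ := by
    rw [dot_inr_mulVec, mulVec_zero, add_zero, hDψ]
  have h3 := abs_dot_mulVec_le_of_psd H hHs hpsd one_pos (Sum.elim 0 ψ) (Sum.elim z 0)
  rw [h2, ← h1, one_mul, inv_one, one_mul] at h3
  have h4 := le_abs_self (ψ ⬝ᵥ (H.toBlocks₂₂).mulVec ψ)
  linarith

omit [DecidableEq ιc] in
/-- **SIZE OF THE HARMONIC EXTENSION**: `‖Ez‖² ≤ (1 + a₀∕d₀)‖z‖²`. [folklore] -/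
theorem norm_hext_sq_le (H : Matrix (ιc ⊕ ιf) (ιc ⊕ ιf) ℝ) (hHs : H.IsSymm) (hpsd : ∀ v, 0 ≤ v ⬝ᵥ H.mulVec v)
    (hD : IsUnit (H.toBlocks₂₂).det) {d₀ a₀ : ℝ} (hd₀ : 0 < d₀)
    (hd : ∀ ψ : ιf → ℝ, d₀ * (ψ ⬝ᵥ ψ) ≤ Sum.elim 0 ψ ⬝ᵥ H.mulVec (Sum.elim 0 ψ))
    (ha : ∀ z : ιc → ℝ, Sum.elim z 0 ⬝ᵥ H.mulVec (Sum.elim z 0) ≤ a₀ * (z ⬝ᵥ z)) (z : ιc → ℝ) :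
    hext H z ⬝ᵥ hext H z ≤ (1 + a₀ / d₀) * (z ⬝ᵥ z) := by
  rw [dot_hext_self]
  set ψ := (H.toBlocks₂₂)⁻¹.mulVec (H.toBlocks₂₁.mulVec z)
  have h1 := hd ψ
  rw [form_inr] at h1
  have h2 := (h1.trans (fluct_energy_le H hHs hpsd hD z)).trans (ha z)
  have h3 : ψ ⬝ᵥ ψ ≤ a₀ / d₀ * (z ⬝ᵥ z) := by
    rw [div_mul_eq_mul_div, le_div_iff₀ hd₀]; linarith
  linarith

/-! ### the correction `χ = ψ^ρ_u − ψ_u` of the conjugated harmonic extension -/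

omit [DecidableEq ιc] in
/-- `hext (conjW ρ H) u = hext H u − (0, χ)` with `χ := ψ^ρ_u − ψ_u`; its `H`-energy is `E_S(u) + ⟨χ,Dχ⟩` and
`⟨χ, D_ρχ⟩ = err_H((0,χ), Eu)`. [folklore] -/
theorem corr_identities (H : Matrix (ιc ⊕ ιf) (ιc ⊕ ιf) ℝ) (hHs : H.IsSymm) (ρ : ιc ⊕ ιf → ℝ)
    (hD : IsUnit (H.toBlocks₂₂).det) (hDρ : IsUnit ((conjW ρ H).toBlocks₂₂).det) (u : ιc → ℝ) :
    let χ : ιf → ℝ := ((conjW ρ H).toBlocks₂₂)⁻¹.mulVec ((conjW ρ H).toBlocks₂₁.mulVec u) -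
      (H.toBlocks₂₂)⁻¹.mulVec (H.toBlocks₂₁.mulVec u)
    hext (conjW ρ H) u = hext H u - Sum.elim (0 : ιc → ℝ) χ ∧
      hext (conjW ρ H) u ⬝ᵥ H.mulVec (hext (conjW ρ H) u) =
          u ⬝ᵥ (schur H).mulVec u + χ ⬝ᵥ (H.toBlocks₂₂).mulVec χ ∧
        χ ⬝ᵥ ((conjW ρ H).toBlocks₂₂).mulVec χ =
          Sum.elim (0 : ιc → ℝ) χ ⬝ᵥ (conjW ρ H).mulVec (hext H u) - Sum.elim (0 : ιc → ℝ) χ ⬝ᵥ H.mulVec (hext H u) := by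
  intro χ
  have hdecomp : hext (conjW ρ H) u = hext H u - Sum.elim (0 : ιc → ℝ) χ := by
    ext i; rcases i with i | i
    · simp only [hext, Sum.elim_inl, Pi.sub_apply, Pi.zero_apply, sub_zero]
    · simp only [hext, Sum.elim_inr, Pi.sub_apply, Pi.neg_apply, χ]; ring
  refine ⟨hdecomp, ?_, ?_⟩
  · -- energy: cross term `⟨(0,χ), H(Eu)⟩ = 0`
    have hcross : Sum.elim 0 χ ⬝ᵥ H.mulVec (hext H u) = 0 := by
      rw [mulVec_hext H hD, sumElim_dotProduct_sumElim, zero_dotProduct, dotProduct_zero, add_zero]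
    have hcross' : hext H u ⬝ᵥ H.mulVec (Sum.elim 0 χ) = 0 := by
      rw [dot_mulVec_comm_of_isSymm H hHs, hcross]
    rw [hdecomp, sub_dotProduct, mulVec_sub, dotProduct_sub, dotProduct_sub, energy_hext H hD, hcross, hcross', form_inr]
    ring
  · -- `⟨χ, D_ρχ⟩ = ⟨(0,χ), H_ρ(Eu)⟩ − 0`
    have hcross : Sum.elim 0 χ ⬝ᵥ H.mulVec (hext H u) = 0 := by
      rw [mulVec_hext H hD, sumElim_dotProduct_sumElim, zero_dotProduct, dotProduct_zero, add_zero]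
    rw [hcross, sub_zero, hext, dot_inr_mulVec, mulVec_neg]
    -- `D_ρχ = C_ρu − D_ρψ_u`
    have : ((conjW ρ H).toBlocks₂₂).mulVec χ =
        (conjW ρ H).toBlocks₂₁.mulVec u - ((conjW ρ H).toBlocks₂₂).mulVec ((H.toBlocks₂₂)⁻¹.mulVec (H.toBlocks₂₁.mulVec u)) := by
      simp only [χ, mulVec_sub]
      rw [mulVec_mulVec, mul_nonsing_inv _ hDρ, one_mulVec]
    rw [this, sub_eq_add_neg]

/-- from `½X² ≤ X·R` (`X, R ≥ 0`) conclude `X ≤ 2R`. [folklore] -/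
theorem le_two_mul_of_sq_le {X R : ℝ} (hX : 0 ≤ X) (hR : 0 ≤ R) (h : X ^ 2 / 2 ≤ X * R) : X ≤ 2 * R := by
  by_cases h0 : X = 0
  · rw [h0]; positivity
  · have hXpos : 0 < X := lt_of_le_of_ne hX (Ne.symm h0)
    nlinarith

omit [DecidableEq ιc] in
/-- **THE CORRECTION IS SMALL IN ENERGY**: `X = √⟨χ,Dχ⟩ ≤ 2κ((1 + 1∕√d₀)‖Eu‖ + √E_S(u)∕√d₀)`. [folklore] -/
theorem corr_energy_le (H : Matrix (ιc ⊕ ιf) (ιc ⊕ ιf) ℝ) (hHs : H.IsSymm) (ρ : ιc ⊕ ιf → ℝ) {σ κ d₀ : ℝ}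
    (hσ : 0 < σ) (hκ : 0 ≤ κ) (hd₀ : 0 < d₀) (hH : ∀ v, σ * (v ⬝ᵥ v) ≤ v ⬝ᵥ H.mulVec v)
    (herr : ∀ v, -(σ / 2) * (v ⬝ᵥ v) ≤ v ⬝ᵥ (conjW ρ H).mulVec v - v ⬝ᵥ H.mulVec v)
    (hb : ∀ v v', |v ⬝ᵥ (conjW ρ H).mulVec v' - v ⬝ᵥ H.mulVec v'| ≤
      κ * (Real.sqrt (v ⬝ᵥ H.mulVec v) * Real.sqrt (v' ⬝ᵥ v') + Real.sqrt (v ⬝ᵥ v) * Real.sqrt (v' ⬝ᵥ H.mulVec v') +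
        Real.sqrt (v ⬝ᵥ v) * Real.sqrt (v' ⬝ᵥ v')))
    (hd : ∀ ψ : ιf → ℝ, d₀ * (ψ ⬝ᵥ ψ) ≤ Sum.elim 0 ψ ⬝ᵥ H.mulVec (Sum.elim 0 ψ)) (u : ιc → ℝ) :
    let χ : ιf → ℝ := ((conjW ρ H).toBlocks₂₂)⁻¹.mulVec ((conjW ρ H).toBlocks₂₁.mulVec u) -
      (H.toBlocks₂₂)⁻¹.mulVec (H.toBlocks₂₁.mulVec u)
    Real.sqrt (χ ⬝ᵥ (H.toBlocks₂₂).mulVec χ) ≤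
        2 * (κ * ((1 + 1 / Real.sqrt d₀) * Real.sqrt (hext H u ⬝ᵥ hext H u) +
          1 / Real.sqrt d₀ * Real.sqrt (u ⬝ᵥ (schur H).mulVec u))) ∧
      Real.sqrt (χ ⬝ᵥ χ) ≤ Real.sqrt (χ ⬝ᵥ (H.toBlocks₂₂).mulVec χ) / Real.sqrt d₀ := by
  intro χ
  have hD := isUnit_D H hσ hH
  obtain ⟨hDρ, henergy⟩ := isUnit_Dρ H ρ hσ hH herr
  obtain ⟨_, _, hid⟩ := corr_identities H hHs ρ hD hDρ u
  set X := Real.sqrt (χ ⬝ᵥ (H.toBlocks₂₂).mulVec χ) with hX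
  have hχχ : 0 ≤ χ ⬝ᵥ χ := by simp only [dotProduct]; exact Finset.sum_nonneg fun _ _ => mul_self_nonneg _
  have hDχ : d₀ * (χ ⬝ᵥ χ) ≤ χ ⬝ᵥ (H.toBlocks₂₂).mulVec χ := by have h := hd χ; rwa [form_inr] at h
  have hE0 : 0 ≤ χ ⬝ᵥ (H.toBlocks₂₂).mulVec χ := le_trans (mul_nonneg hd₀.le hχχ) hDχ
  have hXX : X ^ 2 = χ ⬝ᵥ (H.toBlocks₂₂).mulVec χ := Real.sq_sqrt hE0
  have hsd : 0 < Real.sqrt d₀ := Real.sqrt_pos.2 hd₀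
  -- `‖χ‖ ≤ X/√d₀`
  have hnorm : Real.sqrt (χ ⬝ᵥ χ) ≤ X / Real.sqrt d₀ := by
    rw [le_div_iff₀ hsd, ← Real.sqrt_mul hχχ]
    exact Real.sqrt_le_sqrt (by linarith)
  refine ⟨?_, hnorm⟩
  -- `X²/2 ≤ ⟨χ, D_ρχ⟩ = err_H((0,χ),Eu) ≤ κ(X‖Eu‖ + ‖χ‖√E_S(u) + ‖χ‖‖Eu‖)`
  have h1 : X ^ 2 / 2 ≤ χ ⬝ᵥ ((conjW ρ H).toBlocks₂₂).mulVec χ := by rw [hXX]; exact henergy χ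
  have h2 := hb (Sum.elim 0 χ) (hext H u)
  rw [← hid, form_inr, energy_hext H hD, dot_sumElim_self, zero_dotProduct, zero_add] at h2
  have h3 : χ ⬝ᵥ ((conjW ρ H).toBlocks₂₂).mulVec χ ≤
      κ * (X * Real.sqrt (hext H u ⬝ᵥ hext H u) + Real.sqrt (χ ⬝ᵥ χ) * Real.sqrt (u ⬝ᵥ (schur H).mulVec u) +
        Real.sqrt (χ ⬝ᵥ χ) * Real.sqrt (hext H u ⬝ᵥ hext H u)) := (le_abs_self _).trans h2
  -- substitute `‖χ‖ ≤ X/√d₀`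
  set N := Real.sqrt (hext H u ⬝ᵥ hext H u) with hN
  set E := Real.sqrt (u ⬝ᵥ (schur H).mulVec u) with hE
  have hN0 : 0 ≤ N := Real.sqrt_nonneg _
  have hE0' : 0 ≤ E := Real.sqrt_nonneg _
  have hX0 : 0 ≤ X := Real.sqrt_nonneg _
  have h4 : X ^ 2 / 2 ≤ X * (κ * ((1 + 1 / Real.sqrt d₀) * N + 1 / Real.sqrt d₀ * E)) := by
    have a1 : Real.sqrt (χ ⬝ᵥ χ) * E ≤ X / Real.sqrt d₀ * E := mul_le_mul_of_nonneg_right hnorm hE0'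
    have a2 : Real.sqrt (χ ⬝ᵥ χ) * N ≤ X / Real.sqrt d₀ * N := mul_le_mul_of_nonneg_right hnorm hN0
    have h5 : χ ⬝ᵥ ((conjW ρ H).toBlocks₂₂).mulVec χ ≤ κ * (X * N + X / Real.sqrt d₀ * E + X / Real.sqrt d₀ * N) :=
      h3.trans (mul_le_mul_of_nonneg_left (by linarith) hκ)
    have e : κ * (X * N + X / Real.sqrt d₀ * E + X / Real.sqrt d₀ * N) =
        X * (κ * ((1 + 1 / Real.sqrt d₀) * N + 1 / Real.sqrt d₀ * E)) := by
      field_simp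
      ring
    linarith [h1, h5, e.le]
  exact le_two_mul_of_sq_le hX0 (by positivity) h4

omit [DecidableEq ιc] [DecidableEq ιf] [Fintype ιf] in
/-- triangle inequality for `√(v⬝v)`: `‖a − b‖ ≤ ‖a‖ + ‖b‖`. [folklore] -/
theorem sqrt_dot_sub_le {ι : Type*} [Fintype ι] (a b : ι → ℝ) :
    Real.sqrt ((a - b) ⬝ᵥ (a - b)) ≤ Real.sqrt (a ⬝ᵥ a) + Real.sqrt (b ⬝ᵥ b) := by
  have haa : 0 ≤ a ⬝ᵥ a := by simp only [dotProduct]; exact Finset.sum_nonneg fun _ _ => mul_self_nonneg _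
  have hbb : 0 ≤ b ⬝ᵥ b := by simp only [dotProduct]; exact Finset.sum_nonneg fun _ _ => mul_self_nonneg _
  have hcs : (a ⬝ᵥ b) ^ 2 ≤ (a ⬝ᵥ a) * (b ⬝ᵥ b) := by
    simpa only [dotProduct, sq] using Finset.sum_mul_sq_le_sq_mul_sq (Finset.univ : Finset ι) a b
  have hab : |a ⬝ᵥ b| ≤ Real.sqrt (a ⬝ᵥ a) * Real.sqrt (b ⬝ᵥ b) := by
    rw [← Real.sqrt_mul haa, ← Real.sqrt_sq_eq_abs]; exact Real.sqrt_le_sqrt hcs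
  have hsum : 0 ≤ Real.sqrt (a ⬝ᵥ a) + Real.sqrt (b ⬝ᵥ b) := by positivity
  calc Real.sqrt ((a - b) ⬝ᵥ (a - b)) ≤ Real.sqrt ((Real.sqrt (a ⬝ᵥ a) + Real.sqrt (b ⬝ᵥ b)) ^ 2) := by
        refine Real.sqrt_le_sqrt ?_
        rw [sub_dotProduct, dotProduct_sub, dotProduct_sub, dotProduct_comm b a, add_sq, Real.sq_sqrt haa, Real.sq_sqrt hbb]
        linarith [neg_abs_le (a ⬝ᵥ b)]
    _ = Real.sqrt (a ⬝ᵥ a) + Real.sqrt (b ⬝ᵥ b) := Real.sqrt_sq hsum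

omit [Fintype ιc] [Fintype ιf] [DecidableEq ιc] [DecidableEq ιf] in
/-- `√(p + q²) ≤ √p + q` for `p, q ≥ 0`. [folklore] -/
theorem sqrt_add_sq_le {p q : ℝ} (hp : 0 ≤ p) (hq : 0 ≤ q) : Real.sqrt (p + q ^ 2) ≤ Real.sqrt p + q := by
  have h : p + q ^ 2 ≤ (Real.sqrt p + q) ^ 2 := by
    rw [add_sq, Real.sq_sqrt hp]; nlinarith [Real.sqrt_nonneg p]
  calc Real.sqrt (p + q ^ 2) ≤ Real.sqrt ((Real.sqrt p + q) ^ 2) := Real.sqrt_le_sqrt h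
    _ = Real.sqrt p + q := Real.sqrt_sq (by positivity)

/-! ### the bound -/

omit [DecidableEq ιc] in
/-- **BILINEAR CONJUGATION ERROR OF THE SCHUR COMPLEMENT, FORM-RELATIVE.**  `H` symmetric and `σ`-coercive (`σ > 0`) with
quadratic conjugation error at `ρ` `≥ −(σ∕2)‖·‖²` and bilinear conjugation error `≤ κ(√E_H(v)‖v′‖ + ‖v‖√E_H(v′) + ‖v‖‖v′‖)`;
fluctuation floor `d₀ > 0` and coarse ceiling `a₀`.  Then for all `z, u` (with `S = schur H`, `E = hext H`, `e² = 1 + a₀∕d₀`,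
`X_u ≤ 2κ((1 + 1∕√d₀)e‖u‖ + √E_S(u)∕√d₀)` the correction energy):
`|⟨z,(conjW ρ_c S)u⟩ − ⟨z,Su⟩| ≤ κ(√E_S(z)·‖E_ρu‖ + ‖Ez‖·√(E_S(u) + X_u²) + ‖Ez‖·‖E_ρu‖)` in the explicit form below. [folklore] -/
theorem bilin_conjError_schur_le (H : Matrix (ιc ⊕ ιf) (ιc ⊕ ιf) ℝ) (hHs : H.IsSymm) (ρ : ιc ⊕ ιf → ℝ) {σ κ d₀ a₀ : ℝ}
    (hσ : 0 < σ) (hκ : 0 ≤ κ) (hd₀ : 0 < d₀)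
    (hH : ∀ v, σ * (v ⬝ᵥ v) ≤ v ⬝ᵥ H.mulVec v)
    (herr : ∀ v, -(σ / 2) * (v ⬝ᵥ v) ≤ v ⬝ᵥ (conjW ρ H).mulVec v - v ⬝ᵥ H.mulVec v)
    (hb : ∀ v v', |v ⬝ᵥ (conjW ρ H).mulVec v' - v ⬝ᵥ H.mulVec v'| ≤
      κ * (Real.sqrt (v ⬝ᵥ H.mulVec v) * Real.sqrt (v' ⬝ᵥ v') + Real.sqrt (v ⬝ᵥ v) * Real.sqrt (v' ⬝ᵥ H.mulVec v') +
        Real.sqrt (v ⬝ᵥ v) * Real.sqrt (v' ⬝ᵥ v')))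
    (hd : ∀ ψ : ιf → ℝ, d₀ * (ψ ⬝ᵥ ψ) ≤ Sum.elim 0 ψ ⬝ᵥ H.mulVec (Sum.elim 0 ψ)) (ha₀ : 0 ≤ a₀)
    (ha : ∀ z : ιc → ℝ, Sum.elim z 0 ⬝ᵥ H.mulVec (Sum.elim z 0) ≤ a₀ * (z ⬝ᵥ z)) (z u : ιc → ℝ) :
    |z ⬝ᵥ (conjW (ρ ∘ Sum.inl) (schur H)).mulVec u - z ⬝ᵥ (schur H).mulVec u| ≤
      κ * (Real.sqrt (z ⬝ᵥ (schur H).mulVec z) *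
            (Real.sqrt (1 + a₀ / d₀) * Real.sqrt (u ⬝ᵥ u) +
              2 * (κ * ((1 + 1 / Real.sqrt d₀) * (Real.sqrt (1 + a₀ / d₀) * Real.sqrt (u ⬝ᵥ u)) +
                1 / Real.sqrt d₀ * Real.sqrt (u ⬝ᵥ (schur H).mulVec u))) / Real.sqrt d₀) +
        Real.sqrt (1 + a₀ / d₀) * Real.sqrt (z ⬝ᵥ z) *
            (Real.sqrt (u ⬝ᵥ (schur H).mulVec u) +
              2 * (κ * ((1 + 1 / Real.sqrt d₀) * (Real.sqrt (1 + a₀ / d₀) * Real.sqrt (u ⬝ᵥ u)) +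
                1 / Real.sqrt d₀ * Real.sqrt (u ⬝ᵥ (schur H).mulVec u)))) +
        Real.sqrt (1 + a₀ / d₀) * Real.sqrt (z ⬝ᵥ z) *
            (Real.sqrt (1 + a₀ / d₀) * Real.sqrt (u ⬝ᵥ u) +
              2 * (κ * ((1 + 1 / Real.sqrt d₀) * (Real.sqrt (1 + a₀ / d₀) * Real.sqrt (u ⬝ᵥ u)) +
                1 / Real.sqrt d₀ * Real.sqrt (u ⬝ᵥ (schur H).mulVec u))) / Real.sqrt d₀)) := by
  have hD := isUnit_D H hσ hH
  obtain ⟨hDρ, henergy⟩ := isUnit_Dρ H ρ hσ hH herr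
  have hpsd : ∀ v, 0 ≤ v ⬝ᵥ H.mulVec v := fun v => le_trans (mul_nonneg hσ.le (by
    simp only [dotProduct]; exact Finset.sum_nonneg fun _ _ => mul_self_nonneg _)) (hH v)
  have nnf : ∀ v : ιf → ℝ, 0 ≤ v ⬝ᵥ v := fun v => by
    simp only [dotProduct]; exact Finset.sum_nonneg fun _ _ => mul_self_nonneg _
  have nns : ∀ v : ιc ⊕ ιf → ℝ, 0 ≤ v ⬝ᵥ v := fun v => by
    simp only [dotProduct]; exact Finset.sum_nonneg fun _ _ => mul_self_nonneg _
  -- abbreviations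
  set S := schur H with hS
  set e := Real.sqrt (1 + a₀ / d₀) with he
  set Nz := Real.sqrt (z ⬝ᵥ z); set Nu := Real.sqrt (u ⬝ᵥ u)
  set Ez' := Real.sqrt (z ⬝ᵥ S.mulVec z); set Eu' := Real.sqrt (u ⬝ᵥ S.mulVec u)
  set Xu := 2 * (κ * ((1 + 1 / Real.sqrt d₀) * (e * Nu) + 1 / Real.sqrt d₀ * Eu')) with hXu
  have he0 : 0 ≤ e := Real.sqrt_nonneg _
  have hNz : 0 ≤ Nz := Real.sqrt_nonneg _
  have hNu : 0 ≤ Nu := Real.sqrt_nonneg _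
  have hEz' : 0 ≤ Ez' := Real.sqrt_nonneg _
  have hEu' : 0 ≤ Eu' := Real.sqrt_nonneg _
  have hsd : 0 < Real.sqrt d₀ := Real.sqrt_pos.2 hd₀
  have hXu0 : 0 ≤ Xu := by positivity
  -- the identity and the bilinear bound of `H`
  rw [bilin_err_schur_eq ρ H hHs hD hDρ z u]
  refine (hb (hext H z) (hext (conjW ρ H) u)).trans ?_
  -- sizes: ‖Ez‖ ≤ e‖z‖, ‖Eu‖ ≤ e‖u‖, √E_H(Ez) = √E_S(z)
  have hEz_norm : Real.sqrt (hext H z ⬝ᵥ hext H z) ≤ e * Nz := by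
    rw [he, ← Real.sqrt_mul (by positivity)]
    exact Real.sqrt_le_sqrt (norm_hext_sq_le H hHs hpsd hD hd₀ hd ha z)
  have hEu_norm : Real.sqrt (hext H u ⬝ᵥ hext H u) ≤ e * Nu := by
    rw [he, ← Real.sqrt_mul (by positivity)]
    exact Real.sqrt_le_sqrt (norm_hext_sq_le H hHs hpsd hD hd₀ hd ha u)
  have hEz_energy : Real.sqrt (hext H z ⬝ᵥ H.mulVec (hext H z)) = Ez' := by rw [energy_hext H hD]
  -- the conjugated extension: `E_ρu = Eu − (0,χ)`, energy `E_S(u) + X²`, `X ≤ Xu`, `‖χ‖ ≤ X/√d₀`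
  obtain ⟨hdecomp, hEn, _⟩ := corr_identities H hHs ρ hD hDρ u
  obtain ⟨hXle, hχle⟩ := corr_energy_le H hHs ρ hσ hκ hd₀ hH herr hb hd u
  set χ : ιf → ℝ := ((conjW ρ H).toBlocks₂₂)⁻¹.mulVec ((conjW ρ H).toBlocks₂₁.mulVec u) -
    (H.toBlocks₂₂)⁻¹.mulVec (H.toBlocks₂₁.mulVec u) with hχ
  set X := Real.sqrt (χ ⬝ᵥ (H.toBlocks₂₂).mulVec χ) with hX
  have hX0 : 0 ≤ X := Real.sqrt_nonneg _
  have hXXu : X ≤ Xu := hXle.trans (by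
    rw [hXu]
    refine mul_le_mul_of_nonneg_left (mul_le_mul_of_nonneg_left (add_le_add
      (mul_le_mul_of_nonneg_left hEu_norm (by positivity)) le_rfl) hκ) (by norm_num))
  have hnormρ : Real.sqrt (hext (conjW ρ H) u ⬝ᵥ hext (conjW ρ H) u) ≤ e * Nu + Xu / Real.sqrt d₀ := by
    rw [hdecomp]
    refine (sqrt_dot_sub_le _ _).trans (add_le_add hEu_norm ?_)
    rw [dot_sumElim_self, zero_dotProduct, zero_add]
    exact hχle.trans (div_le_div_of_nonneg_right hXXu hsd.le)
  have henergyρ : Real.sqrt (hext (conjW ρ H) u ⬝ᵥ H.mulVec (hext (conjW ρ H) u)) ≤ Eu' + Xu := by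
    rw [hEn, ← Real.sq_sqrt (show 0 ≤ χ ⬝ᵥ (H.toBlocks₂₂).mulVec χ from by
      have h := hd χ; rw [form_inr] at h; exact le_trans (mul_nonneg hd₀.le (nnf χ)) h)]
    refine (sqrt_add_sq_le ?_ hX0).trans (add_le_add le_rfl hXXu)
    have := hH (hext H u); rw [energy_hext H hD] at this
    exact le_trans (mul_nonneg hσ.le (nns _)) this
  -- assemble the three products
  have hρnn : 0 ≤ Real.sqrt (hext (conjW ρ H) u ⬝ᵥ hext (conjW ρ H) u) := Real.sqrt_nonneg _
  have T1 : Real.sqrt (hext H z ⬝ᵥ H.mulVec (hext H z)) * Real.sqrt (hext (conjW ρ H) u ⬝ᵥ hext (conjW ρ H) u) ≤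
      Ez' * (e * Nu + Xu / Real.sqrt d₀) := by
    rw [hEz_energy]; exact mul_le_mul_of_nonneg_left hnormρ hEz'
  have T2 : Real.sqrt (hext H z ⬝ᵥ hext H z) * Real.sqrt (hext (conjW ρ H) u ⬝ᵥ H.mulVec (hext (conjW ρ H) u)) ≤
      e * Nz * (Eu' + Xu) := mul_le_mul hEz_norm henergyρ (Real.sqrt_nonneg _) (by positivity)
  have T3 : Real.sqrt (hext H z ⬝ᵥ hext H z) * Real.sqrt (hext (conjW ρ H) u ⬝ᵥ hext (conjW ρ H) u) ≤
      e * Nz * (e * Nu + Xu / Real.sqrt d₀) := mul_le_mul hEz_norm hnormρ hρnn (by positivity)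
  exact mul_le_mul_of_nonneg_left (add_le_add (add_le_add T1 T2) T3) hκ

end Summit.QuantumFields.BalabanUV.T4Continuum.NE7K1LinSchurBilinError
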